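import Literature.Geometry.Manifold.CechSmoothSingular
import Literature.Geometry.Manifold.ChartConvexToSmooth
import Literature.Algebra.Homology.DoubleComplexZigzag
import HarnessLib

/-!
# The integral staircase in the Čech–smooth-singular double complex

For an open family `𝔘 = (U_i)` of a `C^∞` manifold all of whose finite intersections `U_J` are
empty or chart sets of convex opens (the shape of a chart-convex cover), and a subgroup `Γ` of the
coefficients (`Γ = ℤ ⊆ ℝ`, `Γ = 0`, …), we prove that the Čech comparison isomorphism
`cechSmoothSingularEquiv : H²(Hom(Δ^{sm,𝔘}, N)) ≃ H²(C•(𝔘, Z⁰_{sm}))` of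
`Literature.Geometry.Manifold.CechSmoothSingular` sends the class of a `𝔘`-small smooth `2`-cocycle
`Z` WITH VALUES IN `Γ` on simplices to the class of a Čech `2`-cocycle of smooth `0`-cocycles WITH
VALUES IN `Γ` (`exists_cechZeroSCocycles_of_isValuedIn`). This is the "integral classes go to
integral Čech classes" half of the Čech integrality step of Lefschetz's theorem on `(1,1)`-classes
(Weil (1952), §3; Bott–Tu (1982), Thm. 15.8 with Prop. 9.5: the isomorphism of a good cover is
computed by the staircase / collating formula), obtained WITHOUT changing coefficients: the column
primitives of the staircase are the explicit ones of the prism (cone) operator of a chart-convex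
set (`Literature.Geometry.Manifold.ChartConePrism`: `φ ↦ χ − φ ∘ P`, Bredon (1993), Lemma V.9.2),
which visibly preserve `Γ`-valuedness since `P` maps a simplex to an integral combination of
simplices.

* `IsValuedIn Γ ψ` — a smooth cochain takes values in `Γ` on the smooth simplices of its set;
* `chartPrim`, `scod_chartPrim`, `isValuedIn_chartPrim` — the explicit `Γ`-preserving primitive of
  smooth cocycles of positive degree on a chart set (`exists_scod_eq_of_isValuedIn` for a set which
  is empty or a chart set); `hacyc_of_isEmptyOrChartSet` — the acyclicity hypothesis of
  `cechSmoothSingularEquiv` for such families;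
* `sEvalSimplex_eq_of_mem_zeroSCocycles` — smooth `0`-cocycles of such a set are constant on points;
* `exists_cechZeroSCocycles_of_isValuedIn` — the `Γ`-valued staircase.

No named facts; everything is proved.

## References

* A. Weil, *Sur les théorèmes de de Rham*, Comment. Math. Helv. 26 (1952), §3.
* R. Bott, L. W. Tu, *Differential Forms in Algebraic Topology* (1982), Prop. 9.5, Thm. 15.8.
  [BottTu1982Forms]
* G. E. Bredon, *Topology and Geometry* (1993), Lemma V.9.2. [Bredon1993]
-/

noncomputable section

-- as in `CechSingular`: chains of the concrete complex are `Finsupp`s up to unfolding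
set_option backward.isDefEq.respectTransparency false

open scoped Manifold ContDiff
open CategoryTheory Literature.Algebra.Homology Literature.Algebra.Homology.ADoubleComplex
  Literature.AlgebraicTopology.SingularHomology
open Literature.Geometry.Kaehler (chartSet)

universe u v w

namespace Literature.Geometry.Manifold

variable {E : Type u} [NormedAddCommGroup E] [NormedSpace ℝ E]
  {H : Type*} [TopologicalSpace H] {I : ModelWithCorners ℝ E H}
  {R : Type v} [CommRing R] {M : Type u} [TopologicalSpace M] [ChartedSpace H M]
  {N : Type w} [AddCommGroup N] [Module R N]

/-! ### Cochains with values in a subgroup -/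

/-- **A smooth cochain of `A` takes values in the subgroup `Γ`** on the smooth simplices of `A`
(e.g. `Γ = ℤ ⊆ ℝ`: an integral cochain). [folklore] -/
def IsValuedIn (Γ : AddSubgroup N) {A : Set M} {q : ℕ} (ψ : SCochainOn I R N A q) : Prop :=
  ∀ σ : SingularSimplex M q, IsSmoothIn I A σ → sEvalSimplex ψ σ ∈ Γ

namespace IsValuedIn

variable {Γ : AddSubgroup N} {A B : Set M} {q : ℕ}

/-- `0` is `Γ`-valued. [folklore] -/
theorem zero : IsValuedIn (I := I) (R := R) Γ (0 : SCochainOn I R N A q) := fun σ hσ ↦ by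
  rw [sEvalSimplex_of_isSmoothIn _ hσ, LinearMap.zero_apply]
  exact Γ.zero_mem

/-- Sums of `Γ`-valued cochains are `Γ`-valued. [folklore] -/
theorem add {ψ ψ' : SCochainOn I R N A q} (h : IsValuedIn Γ ψ) (h' : IsValuedIn Γ ψ') :
    IsValuedIn Γ (ψ + ψ') := fun σ hσ ↦ by
  rw [sEvalSimplex_add]
  exact Γ.add_mem (h σ hσ) (h' σ hσ)

/-- Negatives of `Γ`-valued cochains are `Γ`-valued. [folklore] -/
theorem neg {ψ : SCochainOn I R N A q} (h : IsValuedIn Γ ψ) : IsValuedIn Γ (-ψ) := fun σ hσ ↦ by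
  rw [sEvalSimplex_of_isSmoothIn _ hσ, LinearMap.neg_apply, ← sEvalSimplex_of_isSmoothIn _ hσ]
  exact Γ.neg_mem (h σ hσ)

/-- Differences of `Γ`-valued cochains are `Γ`-valued. [folklore] -/
theorem sub {ψ ψ' : SCochainOn I R N A q} (h : IsValuedIn Γ ψ) (h' : IsValuedIn Γ ψ') :
    IsValuedIn Γ (ψ - ψ') := by
  rw [sub_eq_add_neg]
  exact h.add h'.neg

/-- Sign multiples `(-1)^i • ψ` of `Γ`-valued cochains are `Γ`-valued. [folklore] -/
theorem neg_one_pow_smul {ψ : SCochainOn I R N A q} (h : IsValuedIn Γ ψ) (i : ℕ) :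
    IsValuedIn Γ ((-1 : R) ^ i • ψ) := fun σ hσ ↦ by
  rw [sEvalSimplex_smul]
  rcases Nat.even_or_odd i with hi | hi
  · rw [hi.neg_one_pow, one_smul]
    exact h σ hσ
  · rw [hi.neg_one_pow, neg_one_smul]
    exact Γ.neg_mem (h σ hσ)

/-- Finite sums of `Γ`-valued cochains are `Γ`-valued. [folklore] -/
theorem sum {β : Type*} (s : Finset β) {ψ : β → SCochainOn I R N A q} (h : ∀ b ∈ s, IsValuedIn Γ (ψ b)) :
    IsValuedIn Γ (∑ b ∈ s, ψ b) := fun σ hσ ↦ by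
  rw [sEvalSimplex_sum]
  exact Γ.sum_mem fun b hb ↦ h b hb σ hσ

/-- Restrictions of `Γ`-valued cochains are `Γ`-valued. [folklore] -/
theorem scres (hAB : A ⊆ B) {ψ : SCochainOn I R N B q} (h : IsValuedIn Γ ψ) :
    IsValuedIn Γ (scres (I := I) hAB q ψ) := fun σ hσ ↦ by
  rw [sEvalSimplex_scres _ _ hσ]
  exact h σ (hσ.mono hAB)

end IsValuedIn

/-- The Čech differential preserves `Γ`-valuedness. [folklore] -/
theorem isValuedIn_cechSδ {Γ : AddSubgroup N} {ι : Type*} (U : ι → Set M) {p q : ℕ}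
    {x : CechSCochain I R N U p q} (h : ∀ J, IsValuedIn Γ (x J)) (J : Fin (p + 2) → ι) :
    IsValuedIn Γ (cechSδ I R N U p q x J) := by
  rw [cechSδ_apply]
  exact IsValuedIn.sum _ fun j _ ↦ ((h _).scres _).neg_one_pow_smul _

/-! ### The `Γ`-preserving primitive on a chart set -/

section Prim

variable [IsManifold I ∞ M] {p : M} {C : Set E} {c : E}
  (hCc : Convex ℝ C) (hCT : C ⊆ (extChartAt I p).target) (hc : c ∈ C)

omit [IsManifold I ∞ M] in
/-- The smooth chains of a chart set lie in the chart set (hypothesis `hS` of `ChartConePrism`).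
[folklore] -/
theorem chartS_le (n : ℕ) :
    smoothChainsInSub I R R M (chartSet I p C) n ≤ chainsIn R R M (chartSet I p C) n :=
  inf_le_right

/-- The prism operator preserves the smooth chains of the chart set (`prismOp_mem_smoothChainsInSub`,
in the shape of the hypothesis `hP` of `ChartConePrism`). [cite: Bredon1993, Lemma V.9.2] -/
theorem prismOp_mem_chartS (n : ℕ) (x : CChain R M n)
    (hx : x ∈ smoothChainsInSub I R R M (chartSet I p C) n) :
    prismOp hCc hCT hc R R n x ∈ smoothChainsInSub I R R M (chartSet I p C) (n + 1) :=
  prismOp_mem_smoothChainsInSub hCc hCT hc R R hx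

omit [IsManifold I ∞ M] in
include hCT hc in
/-- The constant simplices at the cone point are smooth chains of the chart set (hypothesis `hconst`
of `ChartConePrism`). [folklore] -/
theorem single_constAt_mem_chartS (n : ℕ) :
    Finsupp.single (SingularSimplex.constAt ((extChartAt I p).symm c) n) (1 : R) ∈
      smoothChainsInSub I R R M (chartSet I p C) n :=
  single_constAt_mem_smoothChainsInSub hCT hc R n

omit [IsManifold I ∞ M] in
/-- The parity correction `χ` of the primitive: `0` (`k` even) or `aug(·) • Φ(κ_{k+1})` (`k` odd).
[cite: Bredon1993, Lemma V.9.2] -/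
def chartPrimχ (k : ℕ) (Φ : ↥(smoothChainsInSub I R R M (chartSet I p C) (k + 1)) →ₗ[R] N) :
    ↥(smoothChainsInSub I R R M (chartSet I p C) k) →ₗ[R] N :=
  if Even k then 0 else
    ((Compression.coeffSum R k).domRestrict (smoothChainsInSub I R R M (chartSet I p C) k)).smulRight
      (Φ ⟨_, single_constAt_mem_chartS hCT hc (k + 1)⟩)

/-- The prism term `Φ ∘ P` of the primitive. [cite: Bredon1993, Lemma V.9.2] -/
def chartPrimP (k : ℕ) (Φ : ↥(smoothChainsInSub I R R M (chartSet I p C) (k + 1)) →ₗ[R] N) :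
    ↥(smoothChainsInSub I R R M (chartSet I p C) k) →ₗ[R] N :=
  Φ ∘ₗ prismOpSub hCc hCT hc (smoothChainsInSub I R R M (chartSet I p C)) (prismOp_mem_chartS hCc hCT hc) k

/-- **The explicit primitive of smooth `(k+1)`-cocycles of a chart set**, on the level of the
submodules of smooth chains: `χ − Φ ∘ P` with `P` the prism operator of the chart contraction and
`χ = 0` (`k` even) or `aug(·) • Φ(κ_{k+1})` (`k` odd) (Bredon (1993), Lemma V.9.2; the formula of
`isZero_homology_dualObj_succ`). [cite: Bredon1993, Lemma V.9.2] -/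
def chartPrimₛ (k : ℕ) (Φ : ↥(smoothChainsInSub I R R M (chartSet I p C) (k + 1)) →ₗ[R] N) :
    ↥(smoothChainsInSub I R R M (chartSet I p C) k) →ₗ[R] N :=
  chartPrimχ hCT hc k Φ - chartPrimP hCc hCT hc k Φ

/-- **`(chartPrimₛ Φ)(∂z) = Φ z` when `Φ ∘ ∂ = 0`** (dualising `∂P + P∂ = κ − 𝟙`, with the parity
correction). [cite: Bredon1993, Lemma V.9.2] -/
theorem chartPrimₛ_bdSub (k : ℕ) (Φ : ↥(smoothChainsInSub I R R M (chartSet I p C) (k + 1)) →ₗ[R] N)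
    (h0 : ∀ w : ↥(smoothChainsInSub I R R M (chartSet I p C) (k + 2)),
      Φ (bdSub (smoothChainsInSub I R R M (chartSet I p C)) (k + 1) w) = 0)
    (z : ↥(smoothChainsInSub I R R M (chartSet I p C) (k + 1))) :
    chartPrimₛ hCc hCT hc k Φ (bdSub (smoothChainsInSub I R R M (chartSet I p C)) k z) = Φ z := by
  set φ₀ : N := Φ ⟨_, single_constAt_mem_chartS hCT hc (k + 1)⟩ with hφ₀
  rw [chartPrimₛ, LinearMap.sub_apply, chartPrimχ, chartPrimP, LinearMap.comp_apply,
    prismOpSub_bdSub hCc hCT hc (smoothChainsInSub I R R M (chartSet I p C)) (chartS_le)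
      (prismOp_mem_chartS hCc hCT hc) (single_constAt_mem_chartS hCT hc),
    map_sub, map_sub, map_smul, h0, sub_zero]
  -- `φ₀ = 0` when `k` is even (the cocycle condition on the constant `(k+2)`-simplex)
  have h2 : Even k → φ₀ = 0 := fun hk ↦ by
    have h := h0 ⟨_, single_constAt_mem_chartS hCT hc (k + 2)⟩
    have hval : bdSub (smoothChainsInSub I R R M (chartSet I p C)) (k + 1)
        ⟨_, single_constAt_mem_chartS hCT hc (k + 2)⟩ = ⟨_, single_constAt_mem_chartS hCT hc (k + 1)⟩ := by
      apply Subtype.ext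
      rw [bdSub_apply_val]
      change csingularChainComplex.bd R (k + 1) (Finsupp.single _ (1 : R)) = Finsupp.single _ 1
      rw [bd_single_constAt, if_neg (by rintro ⟨r, hr⟩; rcases hk with ⟨r', hr'⟩; omega)]
    rwa [hval] at h
  by_cases hk : Even k
  · rw [if_pos hk, LinearMap.zero_apply, ← hφ₀, h2 hk, smul_zero, zero_sub, zero_sub, neg_neg]
  · rw [if_neg hk]
    change Compression.coeffSum R k (bdSub (smoothChainsInSub I R R M (chartSet I p C)) k z).1 • φ₀ -
        (Compression.coeffSum R (k + 1) z.1 • φ₀ - Φ z) = Φ z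
    rw [bdSub_apply_val, coeffSum_bd, if_neg hk]
    abel

/-- The prism simplices of a smooth simplex of the chart set are smooth simplices of the chart set.
[cite: Bredon1993, Thm. V.9.5] -/
theorem isSmoothIn_prismSimplex {n k : ℕ} {σ : SingularSimplex M n} (hσ : IsSmoothIn I (chartSet I p C) σ)
    (θ : Fin (k + 1) → Fin (n + 1) × Fin 2) :
    IsSmoothIn I (chartSet I p C) (prismSimplex hCc hCT hc σ hσ.2 θ) :=
  ⟨isSmooth_prismSimplex hCc hCT hc hσ.1 hσ.2 θ, range_prismSimplex_subset hCc hCT hc hσ.2 θ⟩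

omit [IsManifold I ∞ M] in
include hCT hc in
/-- The constant simplices at the cone point are smooth simplices of the chart set. [folklore] -/
theorem isSmoothIn_constAt (n : ℕ) :
    IsSmoothIn I (chartSet I p C) (SingularSimplex.constAt ((extChartAt I p).symm c) n) :=
  ⟨isSmooth_constAt _ n, range_constAt_symm_subset hCT hc n⟩

/-- **The primitive preserves `Γ`-valuedness on elementary chains**: `P` of a simplex is an
integral combination of simplices, `χ` of a simplex is `0` or the value on the constant simplex.
[cite: Bredon1993, Lemma V.9.2] -/
theorem chartPrimₛ_single_mem (Γ : AddSubgroup N) (k : ℕ)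
    (Φ : ↥(smoothChainsInSub I R R M (chartSet I p C) (k + 1)) →ₗ[R] N)
    (hv : ∀ (τ : SingularSimplex M (k + 1)) (hτ : IsSmoothIn I (chartSet I p C) τ),
      Φ ⟨Finsupp.single τ 1, single_mem_smoothChainsInSub hτ.1 hτ.2 1⟩ ∈ Γ)
    {τ : SingularSimplex M k} (hτ : IsSmoothIn I (chartSet I p C) τ) :
    chartPrimₛ hCc hCT hc k Φ ⟨Finsupp.single τ 1, single_mem_smoothChainsInSub hτ.1 hτ.2 1⟩ ∈ Γ := by
  rw [chartPrimₛ, LinearMap.sub_apply, chartPrimχ, chartPrimP, LinearMap.comp_apply]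
  refine Γ.sub_mem ?_ ?_
  · by_cases hk : Even k
    · rw [if_pos hk, LinearMap.zero_apply]
      exact Γ.zero_mem
    · rw [if_neg hk]
      change Compression.coeffSum R k (Finsupp.single τ 1) •
        Φ ⟨_, single_constAt_mem_chartS hCT hc (k + 1)⟩ ∈ Γ
      rw [Compression.coeffSum_single, one_smul]
      exact hv _ (isSmoothIn_constAt (I := I) hCT hc (k + 1))
  · have hval : prismOpSub hCc hCT hc (smoothChainsInSub I R R M (chartSet I p C)) (prismOp_mem_chartS hCc hCT hc) k
        ⟨Finsupp.single τ 1, single_mem_smoothChainsInSub hτ.1 hτ.2 1⟩ =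
        ∑ i : Fin (k + 1), ((-1 : R) ^ (i : ℕ)) •
          (⟨Finsupp.single (prismSimplex hCc hCT hc τ hτ.2 (Prism.prismMap k i)) 1,
            single_mem_smoothChainsInSub (isSmoothIn_prismSimplex hCc hCT hc hτ (Prism.prismMap k i)).1
              (isSmoothIn_prismSimplex hCc hCT hc hτ (Prism.prismMap k i)).2 1⟩ :
            ↥(smoothChainsInSub I R R M (chartSet I p C) (k + 1))) := by
      apply Subtype.ext
      rw [prismOpSub_apply_val, prismOp_single hCc hCT hc hτ.2, Submodule.coe_sum]
      refine Finset.sum_congr rfl fun i _ ↦ ?_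
      rw [Submodule.coe_smul]
    rw [hval, map_sum]
    refine Γ.sum_mem fun i _ ↦ ?_
    rw [map_smul]
    rcases Nat.even_or_odd (i : ℕ) with he | ho
    · rw [he.neg_one_pow, one_smul]
      exact hv _ (isSmoothIn_prismSimplex hCc hCT hc hτ (Prism.prismMap k i))
    · rw [ho.neg_one_pow, neg_one_smul]
      exact Γ.neg_mem (hv _ (isSmoothIn_prismSimplex hCc hCT hc hτ (Prism.prismMap k i)))

include hCc in
/-- **Smooth `0`-cocycles of a chart set are constant on points**: `Φ(z) = aug(z) Φ(κ₀)` when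
`Φ ∘ ∂ = 0` (Bredon (1993), Lemma V.9.2, degree `0`). [cite: Bredon1993, Lemma V.9.2] -/
theorem apply_eq_coeffSum_smul_of_bdSub (Φ : ↥(smoothChainsInSub I R R M (chartSet I p C) 0) →ₗ[R] N)
    (h0 : ∀ w : ↥(smoothChainsInSub I R R M (chartSet I p C) 1),
      Φ (bdSub (smoothChainsInSub I R R M (chartSet I p C)) 0 w) = 0)
    (z : ↥(smoothChainsInSub I R R M (chartSet I p C) 0)) :
    Φ z = Compression.coeffSum R 0 z.1 • Φ ⟨_, single_constAt_mem_chartS hCT hc 0⟩ := by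
  conv_lhs => rw [eq_coeffSum_smul_sub_bdSub hCc hCT hc (smoothChainsInSub I R R M (chartSet I p C)) (chartS_le)
    (prismOp_mem_chartS hCc hCT hc) (single_constAt_mem_chartS hCT hc) z]
  rw [map_sub, h0, sub_zero, map_smul]

include hCc hCT hc in
/-- On a chart set, a `0`-cochain with `Φ ∘ ∂ = 0` has the same value on any two smooth
`0`-simplices. [cite: Bredon1993, Lemma V.9.2] -/
theorem apply_single_eq_apply_single_of_bdSub (Φ : ↥(smoothChainsInSub I R R M (chartSet I p C) 0) →ₗ[R] N)
    (h0 : ∀ w : ↥(smoothChainsInSub I R R M (chartSet I p C) 1),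
      Φ (bdSub (smoothChainsInSub I R R M (chartSet I p C)) 0 w) = 0)
    {σ τ : SingularSimplex M 0} (hσ : IsSmoothIn I (chartSet I p C) σ) (hτ : IsSmoothIn I (chartSet I p C) τ) :
    Φ ⟨Finsupp.single σ 1, single_mem_smoothChainsInSub hσ.1 hσ.2 1⟩ =
      Φ ⟨Finsupp.single τ 1, single_mem_smoothChainsInSub hτ.1 hτ.2 1⟩ := by
  have h := fun (ρ : SingularSimplex M 0) (hρ : IsSmoothIn I (chartSet I p C) ρ) ↦
    apply_eq_coeffSum_smul_of_bdSub hCc hCT hc Φ h0 ⟨Finsupp.single ρ 1, single_mem_smoothChainsInSub hρ.1 hρ.2 1⟩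
  rw [h σ hσ, h τ hτ]
  change Compression.coeffSum R 0 (Finsupp.single σ 1) • Φ ⟨_, single_constAt_mem_chartS hCT hc 0⟩ =
    Compression.coeffSum R 0 (Finsupp.single τ 1) • Φ ⟨_, single_constAt_mem_chartS hCT hc 0⟩
  rw [Compression.coeffSum_single, Compression.coeffSum_single]

omit [IsManifold I ∞ M] in
/-- The cocycle condition, on the restricted boundary. [folklore] -/
theorem apply_bdSub_eq_zero_of_scod_eq_zero {A : Set M} {q : ℕ} {Φ : SCochainOn I R N A q}
    (hΦ : scod A q Φ = 0) (w : ↥(smoothChainsInSub I R R M A (q + 1))) :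
    Φ (bdSub (smoothChainsInSub I R R M A) q w) = 0 := by
  have h := LinearMap.congr_fun hΦ w
  rw [scod_apply, LinearMap.zero_apply] at h
  change Φ ((smoothChainsInSub I R R M A).toComplex.d (q + 1) q w) = 0 at h
  rwa [toComplex_d_eq_bdSub] at h

/-- **The explicit `Γ`-preserving primitive of smooth `(k+1)`-cocycles of a chart set**, on the
concrete smooth cochains. [cite: Bredon1993, Lemma V.9.2] -/
def chartPrim (k : ℕ) (Φ : SCochainOn I R N (chartSet I p C) (k + 1)) : SCochainOn I R N (chartSet I p C) k :=
  chartPrimₛ hCc hCT hc k Φ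

/-- **`δ(chartPrim Φ) = Φ` for a cocycle `Φ`.** [cite: Bredon1993, Lemma V.9.2] -/
theorem scod_chartPrim (k : ℕ) (Φ : SCochainOn I R N (chartSet I p C) (k + 1))
    (hΦ : scod (chartSet I p C) (k + 1) Φ = 0) :
    scod (chartSet I p C) k (chartPrim hCc hCT hc k Φ) = Φ :=
  LinearMap.ext fun z ↦ by
    rw [scod_apply]
    exact (congrArg (chartPrimₛ hCc hCT hc k Φ)
      (toComplex_d_eq_bdSub (smoothChainsInSub I R R M (chartSet I p C)) k z)).trans
        (chartPrimₛ_bdSub hCc hCT hc k Φ (apply_bdSub_eq_zero_of_scod_eq_zero hΦ) z)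

/-- **The primitive preserves `Γ`-valuedness.** [cite: Bredon1993, Lemma V.9.2] -/
theorem isValuedIn_chartPrim {Γ : AddSubgroup N} {k : ℕ} {Φ : SCochainOn I R N (chartSet I p C) (k + 1)}
    (hv : IsValuedIn Γ Φ) : IsValuedIn Γ (chartPrim hCc hCT hc k Φ) := fun τ hτ ↦ by
  rw [sEvalSimplex_of_isSmoothIn _ hτ]
  exact chartPrimₛ_single_mem hCc hCT hc Γ k Φ (fun τ' hτ' ↦ by
    have h := hv τ' hτ'
    rwa [sEvalSimplex_of_isSmoothIn _ hτ'] at h) hτ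

include hCc hCT hc in
/-- On a chart set, a smooth `0`-cocycle has the same value on any two smooth `0`-simplices.
[cite: Bredon1993, Lemma V.9.2] -/
theorem sEvalSimplex_eq_of_scod_eq_zero_chartSet (Φ : SCochainOn I R N (chartSet I p C) 0)
    (hΦ : scod (chartSet I p C) 0 Φ = 0) {σ τ : SingularSimplex M 0}
    (hσ : IsSmoothIn I (chartSet I p C) σ) (hτ : IsSmoothIn I (chartSet I p C) τ) :
    sEvalSimplex Φ σ = sEvalSimplex Φ τ := by
  rw [sEvalSimplex_of_isSmoothIn _ hσ, sEvalSimplex_of_isSmoothIn _ hτ]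
  exact apply_single_eq_apply_single_of_bdSub hCc hCT hc Φ (apply_bdSub_eq_zero_of_scod_eq_zero hΦ) hσ hτ

end Prim

/-! ### Sets which are empty or chart sets of convex opens -/

section EmptyOrChart

variable [IsManifold I ∞ M] {W : Set M}

omit [IsManifold I ∞ M] in
/-- The smooth chains of the empty set vanish. [folklore] -/
theorem eq_zero_of_eq_empty (hW : W = ∅) {q : ℕ} (x : (smoothChainsInSub I R R M W).toComplex.X q) : x = 0 := by
  apply Subtype.ext
  have h := (mem_chainsIn_iff R R _).1 x.2.2
  change (x.1 : CChain R M q) = 0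
  refine Finsupp.ext fun σ ↦ ?_
  by_contra hσ
  exact (SingularSimplex.range_nonempty σ).ne_empty
    (Set.subset_empty_iff.1 (hW ▸ h σ (Finsupp.mem_support_iff.2 hσ)))

omit [IsManifold I ∞ M] in
/-- Smooth cochains of the empty set vanish. [folklore] -/
theorem sCochainOn_eq_zero_of_eq_empty (hW : W = ∅) {q : ℕ} (ψ : SCochainOn I R N W q) : ψ = 0 :=
  LinearMap.ext fun x ↦ by rw [eq_zero_of_eq_empty hW x, map_zero, LinearMap.zero_apply]

/-- **`Γ`-valued acyclicity of a set which is empty or a chart set of a convex open**: every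
`Γ`-valued smooth `(q+1)`-cocycle is the coboundary of a `Γ`-valued smooth `q`-cochain.
[cite: Bredon1993, Lemma V.9.2] -/
theorem exists_scod_eq_of_isValuedIn
    (hW : W = ∅ ∨ ∃ (p : M) (C : Set E), Convex ℝ C ∧ C ⊆ (extChartAt I p).target ∧ W = chartSet I p C)
    (Γ : AddSubgroup N) {q : ℕ} (ψ : SCochainOn I R N W (q + 1)) (hψ : scod W (q + 1) ψ = 0)
    (hv : IsValuedIn Γ ψ) :
    ∃ φ : SCochainOn I R N W q, scod W q φ = ψ ∧ IsValuedIn Γ φ := by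
  rcases hW with hW | ⟨p, C, hCc, hCT, rfl⟩
  · exact ⟨0, by rw [map_zero, sCochainOn_eq_zero_of_eq_empty hW ψ], IsValuedIn.zero⟩
  · rcases C.eq_empty_or_nonempty with hC | ⟨c, hc⟩
    · have hW : chartSet I p C = ∅ := by
        rw [hC]
        ext x
        simp [chartSet]
      exact ⟨0, by rw [map_zero, sCochainOn_eq_zero_of_eq_empty hW ψ], IsValuedIn.zero⟩
    · exact ⟨chartPrim hCc hCT hc q ψ, scod_chartPrim hCc hCT hc q ψ hψ, isValuedIn_chartPrim hCc hCT hc hv⟩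

/-- **Smooth `0`-cocycles of a set which is empty or a chart set of a convex open are constant on
points.** [cite: Bredon1993, Lemma V.9.2] -/
theorem sEvalSimplex_eq_of_mem_zeroSCocycles
    (hW : W = ∅ ∨ ∃ (p : M) (C : Set E), Convex ℝ C ∧ C ⊆ (extChartAt I p).target ∧ W = chartSet I p C)
    {Φ : SCochainOn I R N W 0} (hΦ : Φ ∈ zeroSCocycles I R N W) {σ τ : SingularSimplex M 0}
    (hσ : IsSmoothIn I W σ) (hτ : IsSmoothIn I W τ) : sEvalSimplex Φ σ = sEvalSimplex Φ τ := by
  rcases hW with hW | ⟨p, C, hCc, hCT, rfl⟩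
  · exact absurd (Set.subset_empty_iff.1 (hW ▸ hσ.2)) (SingularSimplex.range_nonempty σ).ne_empty
  · rcases C.eq_empty_or_nonempty with hC | ⟨c, hc⟩
    · have hW : chartSet I p C = ∅ := by
        rw [hC]
        ext x
        simp [chartSet]
      exact absurd (Set.subset_empty_iff.1 (hW ▸ hσ.2)) (SingularSimplex.range_nonempty σ).ne_empty
    · exact sEvalSimplex_eq_of_scod_eq_zero_chartSet hCc hCT hc Φ (LinearMap.mem_ker.1 hΦ) hσ hτ

end EmptyOrChart

/-! ### The `Γ`-valued staircase -/

section Staircase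

variable [IsManifold I ∞ M] {ι : Type*} (U : ι → Set M)
  (hW : ∀ {m : ℕ} (J : Fin (m + 1) → ι), cechSet U J = ∅ ∨
    ∃ (p : M) (C : Set E), Convex ℝ C ∧ C ⊆ (extChartAt I p).target ∧ cechSet U J = chartSet I p C)

include hW in
/-- **The acyclicity hypothesis of `cechSmoothSingularEquiv`** for a family whose finite
intersections are empty or chart sets of convex opens. [cite: Bredon1993, Lemma V.9.2] -/
theorem hacyc_of_isEmptyOrChartSet (p q : ℕ) (J : Fin (p + 1) → ι)
    (ψ : SCochainOn I R N (cechSet U J) (q + 1)) (hψ : scod (cechSet U J) (q + 1) ψ = 0) :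
    ∃ φ : SCochainOn I R N (cechSet U J) q, scod (cechSet U J) q φ = ψ := by
  obtain ⟨φ, hφ, -⟩ := exists_scod_eq_of_isValuedIn (hW J) ⊤ ψ hψ fun _ _ ↦ trivial
  exact ⟨φ, hφ⟩

/-- **The `Γ`-valued staircase.** If `Z` is a `𝔘`-small smooth `2`-cocycle whose restrictions to
the `U_j` take values in `Γ` on smooth simplices, then `cechSmoothSingularEquiv [Z] = [b]` for a
Čech `2`-cocycle `b` of smooth `0`-cocycles taking values in `Γ`: descend the staircase
`Z|U_j = δ y¹_j`, `(δ̌ y¹)_{ij} = δ y⁰_{ij}`, `b = −δ̌ y⁰` with the `Γ`-preserving primitives of the chart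
sets, and apply the collating formula `ADoubleComplex.rowColEquiv_mk_eq_mk_of_totalD`.
[cite: BottTu1982Forms, Prop. 9.5] -/
theorem exists_cechZeroSCocycles_of_isValuedIn (Γ : AddSubgroup N) (Z : SmoothSmallCochain I R N U 2)
    (hZ : Z ∈ NatCochain.cocycles (cechSmoothSingularRow I R N U).dA 2)
    (hv : ∀ J : Fin 1 → ι, IsValuedIn Γ ((cechSmoothSingularRow I R N U).ε 2 Z J)) :
    ∃ (b : CechZeroSCocycles I R N U 2) (hb : b ∈ NatCochain.cocycles (cechZeroSδ I R N U) 2),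
      (∀ J, IsValuedIn Γ (b J : SCochainOn I R N (cechSet U J) 0)) ∧
      cechSmoothSingularEquiv U (hacyc_of_isEmptyOrChartSet (R := R) (N := N) U hW) 2
          (NatCochain.Cohomology.mk (cechSmoothSingularRow I R N U).dA 2 ⟨Z, hZ⟩) =
        NatCochain.Cohomology.mk (cechZeroSδ I R N U) 2 ⟨b, hb⟩ := by
  -- notation
  set K := cechSmoothSingular I R N U with hK
  set Er := cechSmoothSingularRow I R N U with hEr
  set Ec := cechSmoothSingularCol I R N U with hEc
  -- the Γ-preserving primitives
  choose prim hprim hprimv using fun (m : ℕ) (J : Fin (m + 1) → ι) (q : ℕ)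
    (ψ : SCochainOn I R N (cechSet U J) (q + 1)) (hψ : scod (cechSet U J) (q + 1) ψ = 0)
    (hvψ : IsValuedIn Γ ψ) ↦ exists_scod_eq_of_isValuedIn (hW J) Γ ψ hψ hvψ
  -- step 1: `Z|U_j = δ x01_j`
  have hdZ : Er.dA 2 Z = 0 := (NatCochain.mem_cocycles_iff _).1 hZ
  have h1 : ∀ J : Fin 1 → ι, scod (cechSet U J) 2 (Er.ε 2 Z J) = 0 := fun J ↦ by
    have h := Er.ε_dA 2 Z
    rw [hdZ, map_zero] at h
    have hJ := (congr_fun h J).symm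
    change cechSd I R N U 0 2 (Er.ε 2 Z) J = 0 at hJ
    rwa [cechSd_apply, pow_zero, one_smul] at hJ
  set x01 : CechSCochain I R N U 0 1 := fun J ↦ prim 0 J 1 (Er.ε 2 Z J) (h1 J) (hv J) with hx01
  have hd01 : cechSd I R N U 0 1 x01 = Er.ε 2 Z := by
    funext J
    rw [cechSd_apply, pow_zero, one_smul]
    exact hprim 0 J 1 _ (h1 J) (hv J)
  have hv01 : ∀ J, IsValuedIn Γ (x01 J) := fun J ↦ hprimv 0 J 1 _ (h1 J) (hv J)
  -- step 2: `(δ̌ x01)_J = δ x10_J`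
  set w : CechSCochain I R N U 1 1 := cechSδ I R N U 0 1 x01 with hw
  have hd11 : cechSd I R N U 1 1 w = 0 := by
    have ha := K.anticomm 0 1 x01
    change cechSδ I R N U 0 2 (cechSd I R N U 0 1 x01) + cechSd I R N U 1 1 (cechSδ I R N U 0 1 x01) = 0 at ha
    rw [hd01] at ha
    have hδε : cechSδ I R N U 0 2 (Er.ε 2 Z) = 0 := Er.δ_ε 2 Z
    rw [hδε] at ha
    simpa using ha
  have h2 : ∀ J : Fin 2 → ι, scod (cechSet U J) 1 (w J) = 0 := fun J ↦ by
    have hJ := congr_fun hd11 J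
    change cechSd I R N U 1 1 w J = 0 at hJ
    rwa [cechSd_apply, pow_one, neg_one_smul, neg_eq_zero] at hJ
  have hvw : ∀ J, IsValuedIn Γ (w J) := fun J ↦ isValuedIn_cechSδ U hv01 J
  set x10 : CechSCochain I R N U 1 0 := fun J ↦ prim 1 J 0 (w J) (h2 J) (hvw J) with hx10
  have hd10 : cechSd I R N U 1 0 x10 = -w := by
    funext J
    rw [cechSd_apply, pow_one, neg_one_smul, Pi.neg_apply]
    exact congrArg Neg.neg (hprim 1 J 0 _ (h2 J) (hvw J))
  have hv10 : ∀ J, IsValuedIn Γ (x10 J) := fun J ↦ hprimv 1 J 0 _ (h2 J) (hvw J)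
  -- step 3: `b = −δ̌ x10` is a Čech cocycle of smooth `0`-cocycles
  have hd20 : cechSd I R N U 2 0 (cechSδ I R N U 1 0 x10) = 0 := by
    have ha := K.anticomm 1 0 x10
    change cechSδ I R N U 1 1 (cechSd I R N U 1 0 x10) + cechSd I R N U 2 0 (cechSδ I R N U 1 0 x10) = 0 at ha
    rw [hd10, map_neg] at ha
    have hδδ : cechSδ I R N U 1 1 w = 0 := K.δ_δ 0 1 x01
    rw [hδδ, neg_zero] at ha
    simpa using ha
  have h3 : ∀ J : Fin 3 → ι, scod (cechSet U J) 0 (cechSδ I R N U 1 0 x10 J) = 0 := fun J ↦ by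
    have hJ := congr_fun hd20 J
    change cechSd I R N U 2 0 (cechSδ I R N U 1 0 x10) J = 0 at hJ
    rwa [cechSd_apply, neg_one_sq, one_smul] at hJ
  set b : CechZeroSCocycles I R N U 2 := fun J ↦ ⟨-cechSδ I R N U 1 0 x10 J, by
    rw [LinearMap.mem_ker, map_neg, h3 J, neg_zero]⟩ with hb
  have hcoeb : ∀ J, (b J : SCochainOn I R N (cechSet U J) 0) = -cechSδ I R N U 1 0 x10 J := fun J ↦ rfl
  have hbc : b ∈ NatCochain.cocycles (cechZeroSδ I R N U) 2 := by
    rw [NatCochain.mem_cocycles_iff]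
    funext J
    rw [Pi.zero_apply]
    apply Subtype.ext
    rw [coe_cechZeroSδ_apply, ZeroMemClass.coe_zero]
    simp only [hcoeb, map_neg, smul_neg, Finset.sum_neg_distrib]
    rw [← cechSδ_apply, neg_eq_zero]
    exact congr_fun (K.δ_δ 1 0 x10) J
  have hvb : ∀ J, IsValuedIn Γ (b J : SCochainOn I R N (cechSet U J) 0) := fun J ↦ by
    rw [hcoeb]
    exact (isValuedIn_cechSδ U hv10 J).neg
  refine ⟨b, hbc, hvb, ?_⟩
  -- step 4: the collating formula
  refine ADoubleComplex.rowColEquiv_mk_eq_mk_of_totalD Er Ec _ _ _ _ ⟨Z, hZ⟩ ⟨b, hbc⟩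
    (single 0 1 x01 + single 1 0 x10) (add_mem (single_mem_Tn R 0 1 _) (single_mem_Tn R 1 0 _)) ?_
  rw [map_add, totalD_single, totalD_single]
  have hε : Ec.ε 2 b = -cechSδ I R N U 1 0 x10 := by
    funext J
    rfl
  change single 0 2 (Er.ε 2 Z) - single 2 0 (Ec.ε 2 b) =
    single 1 1 (cechSδ I R N U 0 1 x01) + single 0 2 (cechSd I R N U 0 1 x01) +
      (single 2 0 (cechSδ I R N U 1 0 x10) + single 1 1 (cechSd I R N U 1 0 x10))
  rw [hε, hd01, hd10, ← hw]
  have hsn : ∀ (p q : ℕ) (v : CechSCochain I R N U p q), single p q (-v) = -single p q v := fun p q v ↦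
    eq_neg_of_add_eq_zero_left (by rw [← single_add, neg_add_cancel, single_zero])
  rw [hsn, hsn]
  abel

end Staircase

end Literature.Geometry.Manifold

end
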